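import Mathlib
import Literature.AlgebraicGeometry.Resolution.CobordantGame
import Summits.ResolutionOfSingularities.ResolutionOfSingularities.Theorems.WeightedInvariantLocalWeightedDropCharTwoDoublePointClassKeys
import Summits.ResolutionOfSingularities.ResolutionOfSingularities.Theorems.WeightedInvariantLocalWeightedDropMonicDoublePointDescends

/-!
# `WeightedInvariant.LocalWeightedDrop`, line `hasse-ridge-face-selection`: the registered stub S2sP `stub_charTwoSeparablePureWon`
# CLOSED BY NAME from the lead's key `stub_monicDoublePointDescends`

Crux item stmt-ResolutionOfSingularities-8899 `LocalWeightedDrop` (route `ResolutionOfSingularities/WeightedInvariant`), skeleton v28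
(b8b73808bd522080).  [OURS · L1 W4.3, chain w43, stub worker 5 (seat res-D-pv-056); bookkeeping: the by-name corollary
`charTwoSeparablePure_of_descends` (p496875) applied to the landed key.]
-/

set_option linter.dupNamespace false -- mandated namespace of this single-conjunct summit

namespace Summit.ResolutionOfSingularities.ResolutionOfSingularities.Theorems

open Literature.AlgebraicGeometry.Resolution

/-- S2sP — THE PURE SEPARABLE CHAR-2 DOUBLE POINTS ARE WON (registered stub of skeleton v28, statement VERBATIM): over an algebraically closed
field of characteristic `2`, given the singular germs in `≤ 2` variables, every monic germ `y² + x₀^a x₁^b · y + A₀(x₀,x₁)` with `a + b ≥ 2` and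
`ord A₀ ≥ 3` is won in the local weighted resolution game.  Proof: the lead's key `stub_monicDoublePointDescends` (every reduced position of the
descent game descends) through `charTwoSeparablePure_of_descends`.  [OURS · L1 W4.3] -/
theorem stub_charTwoSeparablePureWon : ∀ (k : Type) [Field k] [CharP k 2] [IsAlgClosed k],
      (∀ m : ℕ, m < 3 → ∀ g : MvPowerSeries (Fin m) k,
        CobordantGame.IsSingular k g → CobordantGame.Won k m g) →
      ∀ (A₀ : MvPowerSeries (Fin 2) k) (a b : ℕ), (2 : ℕ∞) < A₀.order → 2 ≤ a + b →
        CobordantGame.Won k 3 (MvPowerSeries.X (Fin.last 2) ^ 2 +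
          (MvPowerSeries.rename (Fin.succAboveEmb (Fin.last 2)) A₀ +
            MvPowerSeries.rename (Fin.succAboveEmb (Fin.last 2)) (MvPowerSeries.X 0 ^ a * MvPowerSeries.X 1 ^ b) *
              MvPowerSeries.X (Fin.last 2))) :=
  charTwoSeparablePure_of_descends stub_monicDoublePointDescends

end Summit.ResolutionOfSingularities.ResolutionOfSingularities.Theorems
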